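import Mathlib
import HarnessLib
import HarnessLib.Audit
import Summits.Langlands.Statement
import HarnessLib.Audit.Status.Attr

/-!
Route: SiegelEisensteinFern

DORMANT since 2026-08-22T18:41:43Z (reconciler: no traction for 5.6 d (last activity item-evidence-added at 2026-08-17T04:24:09Z); parked, not closed — `ledger route dormant route-Langlands-SiegelEisensteinFern --off` to reactivate) — unstaffed, not closed; items shared with open routes are served there. `ledger route dormant <id> --off` reactivates.

SIEGEL–EISENSTEIN FERN (idea card Langlands/Langlands/siegel-eisenstein-fern; HLTT run backwards).
Let K be a CM field containing an
imaginary quadratic field in which ℓ splits, n ≥ 2, ι : ℚ̄_ℓ ≃ ℂ, and ρ : Γ_K → GL_n(ℚ̄_ℓ)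
irreducible, NOT conjugate self-dual up to twist,
unramified almost everywhere and crystalline-ordinary with distinct Hodge–Tate weights at every v ∣
ℓ. Put R₀ := ρ ⊕ ρ^{c,∨} ⊗ μ for an
algebraic character μ with μ^c = μ making R₀ regular; R₀ is polarized and of Siegel–Eisenstein
shape. THESIS X (it suffices to show): every
such ρ is automorphic — there is a cuspidal L-algebraic π of GL_n(𝔸_K) whose Satake parameters match
the Frobenius characteristic polynomials of
ρ at almost all places (= decl SiegelFernTarget; the ordinary, regular, CM slice of direction (B)
Summit.Langlands.GaloisToAutomorphic in the
a.e.-matching form of Literature.NumberTheory.Automorphic.FontaineMazurLanglandsGLn). It is reached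
in two steps that never patch ρ itself:
(C1, SiegelLimitExistence) the trace of R₀ is an ℓ-adic limit, uniform on Γ_K, of traces of Galois
representations attached to cuspidal
(discrete), polarized, crystalline-ordinary regular algebraic automorphic representations of
U(n,n)-type (isobaric sums ⊞Π_j of cuspidal
Π_j on GL_{d_j}(𝔸_K), Σ d_j = 2n) of tame level bounded by that of R₀ — the infinite fern of the
definite/quasi-split unitary group in 2n
variables run AT the residually reducible Siegel point; (C2, SiegelLimitReciprocity) such a limit of
Siegel shape is automorphic on the Siegel
Levi: Hida control on U(n,n) makes the limit eigensystem classical of regular weight,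
purity/irreducibility forbid it to be cuspidal, so it is
boundary = Ind from a cuspidal π on GL_n(𝔸_K) (Harris 1984), and HLTT's theorem for π gives r(π) ⊕
r(π)^{c∨}μ = R₀, i.e. ρ ≅ r(π).
Lean (one line, elaborated on the farm 2026-08-15, full text = item SiegelFernTarget): ∀ K
[IsCMField K] n hcpt, 2 ≤ n → ∀ ℓ ι,
HasSplitImaginaryQuadraticSubfield K ℓ → ∀ c (≠ 1 in Gal(K/K⁺)) ρ, irreducible → ¬polarizable → a.e.
unramified → crystalline-ordinary
regular at v ∣ ℓ → ∃ π : CuspidalAutomorphicRepData n K hcpt, π.1.IsLAlgebraic ∧ ∀ᶠ v, ∃ α,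
HasSatakeParamAt v α ∧ ρ.IsUnramifiedAt v ∧
ρ.HasFrobCharpolyAt v (arithFrobPolyOfSatake ι q_v 1 α).

Rationale: WHY THIS LINE. Direction (B) for non-polarizable ρ over CM fields is known only through
positive-defect (derived) patching on GL_n (ACCGHLNSTT2023;
barrier TaylorWilesNumericalCoincidenceNarrow). HLTT (HarrisLanTaylorThorneRMS2016 §6: p.90 Lemma
6.2/Cor 6.3–6.4 "Hecke algebras of Galois
type", p.101 Cor 6.23–6.27, read) CONSTRUCT r(π) as a summand of the ℓ-adic limit R₀ = r(π) ⊕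
r(π)^{c∨}ε^{1-2n-2N} of Galois representations
of cuspidal polarized forms on U(n,n). We run it backwards: the non-polarizable ρ is never patched;
it is caught as the reducible Siegel–Eisenstein
limit point of the POLARIZED world, where defect is zero (CHT coincidence holds for U(2n)), ferns
exist (Chenevier2011, HMS arXiv:1811.09116)
and Hida theory controls ordinary forms incl. the boundary (Hida2002, Harris1984, SkinnerUrban2014).
Imports: p-adic families/eigenvarieties
+ Eisenstein cohomology of Shimura varieties, pointed at a reducible point. No cross-field analogy
is used.
RANKED CRUXES (all typed, Sketch.lean rc 0; GL-level statements because U(n,n), eigenvarieties, Hida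
families are not in the tree — they live in
the proofs): rank 2 SiegelLimitExistence = the fern/density AT the Siegel point (everything new is
here: no lifting/density theorem exists at a
residual point whose polarization SWAPS the two constituents; Thorne2014/AllenNewtonThorne2020 treat
sums of individually polarized pieces);
rank 3 SiegelLimitReciprocity = ordinary Siegel-shaped limits are automorphic on the Levi
(classicality of an Eisenstein ordinary eigensystem of
regular weight on U(n,n) WITH boundary, then Harris 1984 + HLTT); rank 4 SiegelGaloisFern = Galois
shadow of C1: R₀ is an ℓ-adic limit of
IRREDUCIBLE polarized representations of the same tame level (dimension count / sign at the
swapped-Siegel point; cheapest real test).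
SUPPORT: SiegelLimitOfAutomorphic (forward direction = HLTT §6 in ordinary form; validates the
interface: if it fails as typed the interface is
wrong), NoProperAutomorphicConstituent (ordinary regular irreducible ρ is never a proper constituent
of r(Π), Π cuspidal RA on GL_d, d > n: the
irreducibility-conjecture input of C2's proof), BeyondSiegelFern (X → Langlands: the rest of the
summit, NOT this route's business).
ASSEMBLY: SiegelLimitExistence → SiegelLimitReciprocity → BeyondSiegelFern → Langlands (a tautology;
proof attached as evidence AssemblyTest.lean).
KILL CRITERIA: (i) ¬SiegelGaloisFern (R₀ isolated from irreducible polarized reps — a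
Bellaïche–Chenevier-type sign obstruction) kills C1 and the
route; (ii) a ρ in BIND whose Siegel trace is provably not a limit of polarized automorphic traces
(e.g. via a congruence obstruction mod ℓ on
U(2n)) refutes C1; (iii) refutation of SiegelLimitOfAutomorphic means the typed interface (cuspidal
families, ordinarity, level clause) is
mis-specified: restate, do not close; (iv) the n = 1 / U(1,1) toy (characters, GL_2/K CM forms) must
reproduce CFT — grounders' first test.
DELIBERATELY NOT DECOMPOSED: C1 into (R^{pol,ord}_{R̄₀} presentation at a reducible determinant,
Chenevier) + (R = T^{ord} for definite U(2n)
at the Siegel-Eisenstein ideal) + (ordinary Eisenstein family through R₀): glue after C3/C1 move; C2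
into classicality / non-cuspidality / boundary
identification: needs U(n,n) objects in Literature first (definition requests to be filed by
tenure). Non-ordinary finite slope, ℓ inert in F₀,
polarizable ρ, n = 1, non-CM fields: other routes (complement BeyondSiegelFern).

Novelty: Nearest prior art (searched: refuter novelty audit on the card 2026-08-15 with 13 ids; this session
HLTT arXiv:1411.6717 pp. 90, 101 read;
lit frontier Langlands --since 2020 (30 rows: arXiv:2603.19768 irreducibility GL(4),
arXiv:2502.10799 images, arXiv:2605.03519 none on point);
zbMATH 'Eisenstein ideal unitary group ordinary Galois representation' (2 rows: AtanasovHarris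
arXiv:2112.06851, Bouganis arXiv:1107.1377, neither
a (B)-route); openalex/s2/arXiv API rate-limited this session). (A)-direction through the SAME
Siegel–Eisenstein locus: HarrisLanTaylorThorneRMS2016
(Cor 6.23–6.27), Scholze2015, and for torsion ACCGHLNSTT2023 §5 (boundary of U(n,n)); (B) for
non-polarizable ρ: ACCGHLNSTT2023 = the only route,
positive-defect GL_n patching; ferns/density for POLARIZED rings at residually IRREDUCIBLE points:
Chenevier2011, arXiv:1811.09116 (HMS),
arXiv:2210.10564; residually reducible polarized lifting with individually polarized constituents:
Thorne2014, AllenNewtonThorne2020; Eisenstein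
points used in the REVERSE direction (automorphic ⇒ Selmer classes): SkinnerUrban2014,
Bellaïche–Chenevier arXiv:math/0602340; residually
reducible FM for GL_2/ℚ via R^{ps} = T with Eisenstein part: Pan2022, SkinnerWiles1999 (there the
reducible points are sums of CHARACTERS,
automorphic by CFT). DELTA: nobody proposes (B) for a non-polarizable n-dimensional ρ by (fern
density of cuspidal polarized points AT the swapped
Siegel–Eisenstein point of U(2n)/U(n,n)) × (classicality of the ordin  [refs: 1411.6717, 2603.19768, 2502.10799, 2605.03519, 2112.06851, 1107.1377, 1811.09116, 2210.10564, math/0602340, HarrisLanTaylorThorneRMS2016, Scholze2015, ACCGHLNSTT2023, Chenevier2011, Thorne2014, AllenNewtonThorne2020, SkinnerUrban2014, Pan2022, SkinnerWiles1999]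

Barriers (technique_class: automorphy-lifting patching defect-zero eigenvariety): technique_class: automorphy-lifting patching defect-zero eigenvariety p-adic-interpolation
eisenstein-cohomology boundary-cohomology hida-theory
- Literature.Barriers.Langlands.TaylorWilesNumericalCoincidence: evaded — no patching/density
argument is ever run for GL_n or for ρ; all of it happens for the polarized group (definite U(2n),
quasi-split U(n,n)) where the CHT coincidence holds (chtCoincidenceGn_totallyOdd in that file); ρ
enters only as a summand of the reducible limit point R₀.
- Literature.Barriers.Langlands.TaylorWilesNumericalCoincidenceNarrow: evaded for the same reason —
the narrow barrier blocks single-degree patching of r WITHOUT a totally odd polarization; here the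
patched/dense objects are the polarized R (deformations of R̄₀ = ρ̄ ⊕ ρ̄^{c∨}μ̄), which admit
pairings of either sign; the bet is exactly that reciprocity for ρ can be read off the polarized
family at its Siegel point.
- Literature.Barriers.Langlands.ResiduallyReducibleBarrier: ENGAGED head-on, not evaded — R̄₀ is
reducible by construction, so Mazur representability and TW-prime existence at R̄₀ fail
(not_taylorWilesImageHypotheses_of_isDecomposable). The bet: density is accumulated at nearby
residually-Siegel but ℓ-adically irreducible polarized points via Chenevier determinants /
Skinner–Wiles–Thorne–ANT-style arguments in the ORDINARY case (Thorne2014, AllenNewtonThorne2020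
cover sums of individually polarized pieces, NOT the swapped Siegel shape — crux
SiegelLimitExistence, why-might-fail rec

History (route lifecycle, newest last):
- 2026-08-16T02:17:41Z · AUTO-CRUX: 1 conjecture-grade item(s) promoted to crux (NoProperAutomorphicConstituent) — refuter vetting / tiering apply (operator:999:1362873)
- 2026-08-22T18:41:43Z · DORMANT — reconciler: no traction for 5.6 d (last activity item-evidence-added at 2026-08-17T04:24:09Z); parked, not closed — `ledger route dormant route-Langlands-Siegel (operator:999:986113)

sub-problem: Langlands · status: dormant · opened planner-plancard-Langlands-Langlands-siegel-e-65281e65-0 2026-08-15T11:07:09Z · rev 3 · ledger route-Langlands-SiegelEisensteinFern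
GENERATED by the gate from the ledger (D-0016/17). Provers cite these decls: `theorem foo : Summit.Langlands.Langlands.Theses.SiegelEisensteinFern.<Decl> := …` in Summits/Langlands/Langlands/Theorems/<Name>.lean.
-/

namespace Summit.Langlands.Langlands.Theses.SiegelEisensteinFern

open scoped BigOperators Topology Manifold Classical MeasureTheory ProbabilityTheory Matrix InnerProductSpace ComplexConjugate ContinuousMap
open Filter Set Function TopologicalSpace MeasureTheory

attribute [summit_statement] _root_.Langlands

/-- item stmt-Langlands-2689 · target · rank 0 · open · by planner
why it might fail: It is a slice of Fontaine–Mazur–Langlands (B): no counterexample expected; fails only if (B) fails for some ordinary regular non-polarizable ρ over a CM field. As typed: K must contain an imaginary quadratic field split at ℓ; n ≥ 2.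
sources: FontaineMazurGeometric1995, ACCGHLNSTT2023, HarrisLanTaylorThorneRMS2016
[target] Thesis X of route SiegelEisensteinFern (card siegel-eisenstein-fern): for K CM containing
an imaginary quadratic field split at ℓ, n ≥ 2, every irreducible, non-polarizable (¬∃χ: tr ρ(θ_c σ)
= χ(σ) tr ρ(σ⁻¹)), a.e. unramified ρ : Γ_K → GL_n(ℚ̄_ℓ) that is crystalline-ordinary with distinct
Hodge–Tate weights at every v ∣ ℓ (conj-upper-triangular on Γ_{K_v}, diagonal = unramified ψ_i ·
ε^{b_i}, b strictly decreasing ⇒ semistable ⇒ de Rham, Perrin-Riou) is automorphic in the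
a.e.-Satake-matching, L-algebraic form of
Literature.NumberTheory.Automorphic.FontaineMazurLanglandsGLn. = the
ordinary/regular/CM/non-polarizable slice of Summit.Langlands.GaloisToAutomorphic (weak form).
Follows from SiegelLimitExistence + SiegelLimitReciprocity (AssemblyTest.lean). Sources:
FontaineMazurGeometric1995 Conj. 1; ACCGHLNSTT2023 Thm 1.0.2-type results are the only known cases
(positive defect); HarrisLanTaylorThorneRMS2016 (the (A) side used backwards). -/
@[route_item "route-Langlands-SiegelEisensteinFern"]
def SiegelFernTarget : Prop :=
  ∀ (K : Type) [Field K] [NumberField K] [NumberField.IsCMField K] (n : ℕ) (hcpt : Literature.NumberTheory.Automorphic.isCompact_glFiniteIntegralLevel n K), 2 ≤ n → ∀ (ℓ : ℕ) [Fact ℓ.Prime] (ι : PadicAlgCl ℓ ≃+* ℂ), (∃ F₀ : IntermediateField ℚ K, (Module.finrank ℚ F₀ = 2 ∧ NumberField.IsTotallyComplex F₀) ∧ ∃ w w' : IsDedekindDomain.HeightOneSpectrum (NumberField.RingOfIntegers F₀), w ≠ w' ∧ (ℓ : NumberField.RingOfIntegers F₀) ∈ w.asIdeal ∧ (ℓ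 : NumberField.RingOfIntegers F₀) ∈ w'.asIdeal) → ∀ (c : Field.absoluteGaloisGroup (NumberField.maximalRealSubfield K)) (θ : Field.absoluteGaloisGroup K →ₜ* Field.absoluteGaloisGroup K), c ∉ Set.range (Literature.NumberTheory.GaloisRepresentations.absGaloisRestrict (NumberField.maximalRealSubfield K) K) → (∀ σ, Literature.NumberTheory.GaloisRepresentations.absGaloisRestrict (NumberField.maximalRealSubfield K) K (θ σ) = c * Literature.NumberTheory.GaloisRepresentations.absGaloisRestrict (NumberField.maximalRealSubfield K) K σ * c⁻¹) → ∀ (ρ : Literature.NumberTheory.GaloisRepresentations.FramedGaloisRep K (PadicAlgCl ℓ) n), ρ.toGaloisRep.IsIrreducible → (¬ ∃ χ : Literature.NumberTheory.GaloisRepresentations.FramedGaloisRep K (PadicAlgCl ℓ) 1, ∀ σ, ρ.trace (θ σ) = χ.trace σ * ρ.trace σ⁻¹) → (∀ᶠ v in Filter.cofinite, ρ.IsUnramifiedAt v) → (∀ v : IsDedekindDomain.HeightOneSpectrum (NumberField.RingOfIntegers K), (ℓ : NumberField.RingOfIntegers K) ∈ v.asIdeal → ∃ (g : Matrix.GeneralLinearGroup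 (Fin (n)) (PadicAlgCl ℓ)) (b : Fin (n) → ℤ) (ψ : Fin (n) → Literature.NumberTheory.GaloisRepresentations.FramedRep (Field.absoluteGaloisGroup (v.adicCompletion K)) (PadicAlgCl ℓ) 1), StrictAnti b ∧ (∀ i, (ψ i).IsLocallyUnramified) ∧ ∀ σ, (∀ i₁ i₂ : Fin (n), i₂ < i₁ → (((ρ).toLocal v).conj g σ).val i₁ i₂ = 0) ∧ (∀ i, (((ρ).toLocal v).conj g σ).val i i = (ψ i).trace σ * (algebraMap ℚ_[ℓ] (PadicAlgCl ℓ) ((Literature.NumberTheory.GaloisRepresentations.GaloisRep.cyclotomicCharacter (v.adicCompletion K) ℓ σ : ℤ_[ℓ]ˣ) : ℤ_[ℓ])) ^ (b i))) → (∃ π : Literature.NumberTheory.Automorphic.CuspidalAutomorphicRepData n K hcpt, π.1.IsLAlgebraic ∧ ∀ᶠ v in Filter.cofinite, ∃ α : Multiset ℂ, π.1.HasSatakeParamAt v α ∧ ρ.IsUnramifiedAt v ∧ ρ.HasFrobCharpolyAt v (Literature.NumberTheory.Automorphic.arithFrobPolyOfSatake ι v.residueCard 1 α))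

/-- item stmt-Langlands-2690 · crux · rank 2 · open · by planner
why it might fail: No lifting/density theorem exists at a residual point whose polarization SWAPS the constituents (Thorne2014/ANT2020 need individually polarized pieces); ordinary R=T may fail at the Siegel-Eisenstein ideal (Eisenstein components are not cuspidal-automorphic); needs l-adic not Zariski density.
sources: Chenevier2011, arXiv:1811.09116, Thorne2014, AllenNewtonThorne2020, SkinnerWiles1999, HarrisLanTaylorThorneRMS2016 §6 (p.90 Lemma 6.2, Cor 6.3-6.4)
[crux] FERN AT THE SIEGEL POINT (card C1): with BIND as in the target, there is an a.e.-unramified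
character μ (intended: μ^c = μ algebraic, chosen so that R₀ = ρ ⊕ ρ^{c∨}μ is ordinary regular and
polarized of the automorphic sign) such that for every M there is a finite family of cuspidal
regular algebraic Π_j on GL_{d_j}(𝔸_K), Σ d_j = 2n, with Galois representations r_j = r_{ℓ,ι}(Π_j)
(lang.S27 matching at all unramified v ∤ ℓ), each r_j crystalline-ordinary regular at v ∣ ℓ and
unramified wherever ρ, μ are (v ∤ ℓ), whose total trace t_M = Σ tr r_j is polarized (t_M(θ_c σ) =
χ(σ) t_M(σ⁻¹)) and satisfies sup_σ ‖t_M(σ) − T(σ)‖ ≤ ℓ^{-M}, T = tr ρ + μ·tr(ρ^c)^∨ (the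
Siegel–Eisenstein trace). Intended proof: in the ordinary polarized deformation space of the
residually reducible determinant R̄₀ = ρ̄ ⊕ ρ̄^{c∨}μ̄ (Chenevier determinants; definite U(2n) and
U(n,n)), show cuspidal ordinary automorphic points are Zariski-dense in every component through R₀
(infinite fern Chenevier2011 / HMS arXiv:1811.09116 transplanted to an Eisenstein residual point;
ordinary R = T at the Siegel–Eisenstein maximal ideal in the style of
SkinnerWiles1999/Thorne2014/AllenNewtonThorne2020), then Zariski dens -/
@[route_item "route-Langlands-SiegelEisensteinFern", crux]
def SiegelLimitExistence : Prop :=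
  ∀ (K : Type) [Field K] [NumberField K] [NumberField.IsCMField K] (n : ℕ) (hcpt : Literature.NumberTheory.Automorphic.isCompact_glFiniteIntegralLevel n K), 2 ≤ n → ∀ (ℓ : ℕ) [Fact ℓ.Prime] (ι : PadicAlgCl ℓ ≃+* ℂ), (∃ F₀ : IntermediateField ℚ K, (Module.finrank ℚ F₀ = 2 ∧ NumberField.IsTotallyComplex F₀) ∧ ∃ w w' : IsDedekindDomain.HeightOneSpectrum (NumberField.RingOfIntegers F₀), w ≠ w' ∧ (ℓ : NumberField.RingOfIntegers F₀) ∈ w.asIdeal ∧ (ℓ : NumberField.RingOfIntegers F₀) ∈ w'.asIdeal) → ∀ (c : Field.absoluteGaloisGroup (NumberField.maximalRealSubfield K)) (θ : Field.absoluteGaloisGroup K →ₜ* Field.absoluteGaloisGroup K), c ∉ Set.range (Literature.NumberTheory.GaloisRepresentations.absGaloisRestrict (NumberField.maximalRealSubfield K) K) → (∀ σ, Literature.NumberTheory.GaloisRepresentations.absGaloisRestrict (NumberField.maximalRealSubfield K) K (θ σ) = c * Literature.NumberTheory.GaloisRepresentations.absGaloisRestrict (NumberField.maximalRealSubfield K)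 K σ * c⁻¹) → ∀ (ρ : Literature.NumberTheory.GaloisRepresentations.FramedGaloisRep K (PadicAlgCl ℓ) n), ρ.toGaloisRep.IsIrreducible → (¬ ∃ χ : Literature.NumberTheory.GaloisRepresentations.FramedGaloisRep K (PadicAlgCl ℓ) 1, ∀ σ, ρ.trace (θ σ) = χ.trace σ * ρ.trace σ⁻¹) → (∀ᶠ v in Filter.cofinite, ρ.IsUnramifiedAt v) → (∀ v : IsDedekindDomain.HeightOneSpectrum (NumberField.RingOfIntegers K), (ℓ : NumberField.RingOfIntegers K) ∈ v.asIdeal → ∃ (g : Matrix.GeneralLinearGroup (Fin (n)) (PadicAlgCl ℓ)) (b : Fin (n) → ℤ) (ψ : Fin (n) → Literature.NumberTheory.GaloisRepresentations.FramedRep (Field.absoluteGaloisGroup (v.adicCompletion K)) (PadicAlgCl ℓ) 1), StrictAnti b ∧ (∀ i, (ψ i).IsLocallyUnramified) ∧ ∀ σ, (∀ i₁ i₂ : Fin (n), i₂ < i₁ → (((ρ).toLocal v).conj g σ).val i₁ i₂ = 0) ∧ (∀ i, (((ρ).toLocal v).conj g σ).val i i = (ψ i).trace σ * (algebraMap ℚ_[ℓ]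 (PadicAlgCl ℓ) ((Literature.NumberTheory.GaloisRepresentations.GaloisRep.cyclotomicCharacter (v.adicCompletion K) ℓ σ : ℤ_[ℓ]ˣ) : ℤ_[ℓ])) ^ (b i))) → ∃ μ : Literature.NumberTheory.GaloisRepresentations.FramedGaloisRep K (PadicAlgCl ℓ) 1, (∀ᶠ v in Filter.cofinite, μ.IsUnramifiedAt v) ∧ (∀ M : ℕ, ∃ (k : ℕ) (d : Fin k → ℕ) (hd : ∀ j, Literature.NumberTheory.Automorphic.isCompact_glFiniteIntegralLevel (d j) K) (P : ∀ j, Literature.NumberTheory.Automorphic.CuspidalAutomorphicRepData (d j) K (hd j)) (r : ∀ j, Literature.NumberTheory.GaloisRepresentations.FramedGaloisRep K (PadicAlgCl ℓ) (d j)), (∑ j, d j = n + n) ∧ (∀ j, (P j).1.IsRegularAlgebraic ∧ (∀ v (α : Multiset ℂ), (P j).1.HasSatakeParamAt v α → (ℓ : NumberField.RingOfIntegers K) ∉ v.asIdeal → (r j).IsUnramifiedAt v ∧ (r j).HasFrobCharpolyAt v (Literature.NumberTheory.Automorphic.arithFrobPolyOfSatake ι v.residueCard (d j) α)) ∧ (∀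 v, ρ.IsUnramifiedAt v → μ.IsUnramifiedAt v → (ℓ : NumberField.RingOfIntegers K) ∉ v.asIdeal → (r j).IsUnramifiedAt v) ∧ (∀ v : IsDedekindDomain.HeightOneSpectrum (NumberField.RingOfIntegers K), (ℓ : NumberField.RingOfIntegers K) ∈ v.asIdeal → ∃ (g : Matrix.GeneralLinearGroup (Fin (d j)) (PadicAlgCl ℓ)) (b : Fin (d j) → ℤ) (ψ : Fin (d j) → Literature.NumberTheory.GaloisRepresentations.FramedRep (Field.absoluteGaloisGroup (v.adicCompletion K)) (PadicAlgCl ℓ) 1), StrictAnti b ∧ (∀ i, (ψ i).IsLocallyUnramified) ∧ ∀ σ, (∀ i₁ i₂ : Fin (d j), i₂ < i₁ → (((r j).toLocal v).conj g σ).val i₁ i₂ = 0) ∧ (∀ i, (((r j).toLocal v).conj g σ).val i i = (ψ i).trace σ * (algebraMap ℚ_[ℓ] (PadicAlgCl ℓ) ((Literature.NumberTheory.GaloisRepresentations.GaloisRep.cyclotomicCharacter (v.adicCompletion K) ℓ σ : ℤ_[ℓ]ˣ) : ℤ_[ℓ])) ^ (b i)))) ∧ (∃ χ : Literature.NumberTheory.GaloisRepresentations.FramedGaloisRep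 K (PadicAlgCl ℓ) 1, ∀ σ, (∑ j, (r j).trace (θ σ)) = χ.trace σ * (∑ j, (r j).trace σ⁻¹)) ∧ (∀ σ, ‖(∑ j, (r j).trace σ) - (ρ.trace σ + μ.trace σ * (Literature.NumberTheory.GaloisRepresentations.FramedRep.dual (ρ.comp θ)).trace σ)‖ ≤ ((ℓ : ℝ)⁻¹) ^ M))

/-- item stmt-Langlands-2691 · crux · rank 3 · open · by planner
why it might fail: Classicality of an ordinary p-adic eigensystem of regular weight that is Eisenstein (boundary) on U(n,n) is not in print beyond U(2,2)-type cases (SkinnerUrban2014); control at the boundary strata and 'sufficiently regular' weight conditions (Hida2002) may exclude the weight of R₀.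
sources: Hida2002, Harris1984, SkinnerUrban2014, Caraiani2012, Mok2014, HarrisLanTaylorThorneRMS2016 Cor 6.26-6.27 (p.101), Thm 7.13
[crux] ORDINARY SIEGEL-SHAPED LIMITS ARE AUTOMORPHIC ON THE LEVI (card C2; HLTT backwards): with
BIND as in the target and ANY character μ, if the Siegel–Eisenstein trace T = tr ρ + μ·tr(ρ^c)^∨ is
an ℓ-adic limit of ordinary polarized cuspidal-automorphic traces in the sense of
SiegelLimitExistence, then ρ is automorphic (∃ cuspidal L-algebraic π on GL_n(𝔸_K) with a.e.
Satake–Frobenius matching). Intended proof: the limit eigensystem lives in the ordinary Hecke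
algebra of U(n,n) at tame level bounded by that of R₀; Hida's control theorem for coherent H⁰ on the
U(n,n) Shimura variety INCLUDING the boundary (Hida2002; the definite form has no boundary and
cannot see R₀) makes it classical of regular weight; a classical eigenform with Galois trace T is
not cuspidal (Caraiani2012 purity: r(Π_j) pure while R₀ has two weights; or
NoProperAutomorphicConstituent), hence its eigensystem is that of a Siegel–Eisenstein series induced
from a cuspidal cohomological π on the Siegel Levi Res GL_n (Harris1984; Mok2014: discrete
parameters of U(n,n) are elliptic, the Siegel shape is not); HLTT Cor 6.26/7.13 for π gives r(π) ⊕
r(π)^{c∨}μ' with trace T, so ρ ≅ r(π) or ρ ≅ r(π^{c∨}⊗μ). The conclusion -/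
@[route_item "route-Langlands-SiegelEisensteinFern", crux]
def SiegelLimitReciprocity : Prop :=
  ∀ (K : Type) [Field K] [NumberField K] [NumberField.IsCMField K] (n : ℕ) (hcpt : Literature.NumberTheory.Automorphic.isCompact_glFiniteIntegralLevel n K), 2 ≤ n → ∀ (ℓ : ℕ) [Fact ℓ.Prime] (ι : PadicAlgCl ℓ ≃+* ℂ), (∃ F₀ : IntermediateField ℚ K, (Module.finrank ℚ F₀ = 2 ∧ NumberField.IsTotallyComplex F₀) ∧ ∃ w w' : IsDedekindDomain.HeightOneSpectrum (NumberField.RingOfIntegers F₀), w ≠ w' ∧ (ℓ : NumberField.RingOfIntegers F₀) ∈ w.asIdeal ∧ (ℓ : NumberField.RingOfIntegers F₀) ∈ w'.asIdeal) → ∀ (c : Field.absoluteGaloisGroup (NumberField.maximalRealSubfield K)) (θ : Field.absoluteGaloisGroup K →ₜ* Field.absoluteGaloisGroup K), c ∉ Set.range (Literature.NumberTheory.GaloisRepresentations.absGaloisRestrict (NumberField.maximalRealSubfield K) K) → (∀ σ, Literature.NumberTheory.GaloisRepresentations.absGaloisRestrict (NumberField.maximalRealSubfield K) K (θ σ) =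 c * Literature.NumberTheory.GaloisRepresentations.absGaloisRestrict (NumberField.maximalRealSubfield K) K σ * c⁻¹) → ∀ (ρ : Literature.NumberTheory.GaloisRepresentations.FramedGaloisRep K (PadicAlgCl ℓ) n), ρ.toGaloisRep.IsIrreducible → (¬ ∃ χ : Literature.NumberTheory.GaloisRepresentations.FramedGaloisRep K (PadicAlgCl ℓ) 1, ∀ σ, ρ.trace (θ σ) = χ.trace σ * ρ.trace σ⁻¹) → (∀ᶠ v in Filter.cofinite, ρ.IsUnramifiedAt v) → (∀ v : IsDedekindDomain.HeightOneSpectrum (NumberField.RingOfIntegers K), (ℓ : NumberField.RingOfIntegers K) ∈ v.asIdeal → ∃ (g : Matrix.GeneralLinearGroup (Fin (n)) (PadicAlgCl ℓ)) (b : Fin (n) → ℤ) (ψ : Fin (n) → Literature.NumberTheory.GaloisRepresentations.FramedRep (Field.absoluteGaloisGroup (v.adicCompletion K)) (PadicAlgCl ℓ) 1), StrictAnti b ∧ (∀ i, (ψ i).IsLocallyUnramified) ∧ ∀ σ, (∀ i₁ i₂ : Fin (n), i₂ < i₁ → (((ρ).toLocal v).conj g σ).val i₁ i₂ = 0) ∧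 (∀ i, (((ρ).toLocal v).conj g σ).val i i = (ψ i).trace σ * (algebraMap ℚ_[ℓ] (PadicAlgCl ℓ) ((Literature.NumberTheory.GaloisRepresentations.GaloisRep.cyclotomicCharacter (v.adicCompletion K) ℓ σ : ℤ_[ℓ]ˣ) : ℤ_[ℓ])) ^ (b i))) → ∀ (μ : Literature.NumberTheory.GaloisRepresentations.FramedGaloisRep K (PadicAlgCl ℓ) 1), (∀ M : ℕ, ∃ (k : ℕ) (d : Fin k → ℕ) (hd : ∀ j, Literature.NumberTheory.Automorphic.isCompact_glFiniteIntegralLevel (d j) K) (P : ∀ j, Literature.NumberTheory.Automorphic.CuspidalAutomorphicRepData (d j) K (hd j)) (r : ∀ j, Literature.NumberTheory.GaloisRepresentations.FramedGaloisRep K (PadicAlgCl ℓ) (d j)), (∑ j, d j = n + n) ∧ (∀ j, (P j).1.IsRegularAlgebraic ∧ (∀ v (α : Multiset ℂ), (P j).1.HasSatakeParamAt v α → (ℓ : NumberField.RingOfIntegers K) ∉ v.asIdeal → (r j).IsUnramifiedAt v ∧ (r j).HasFrobCharpolyAt v (Literature.NumberTheory.Automorphic.arithFrobPolyOfSatake ι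 v.residueCard (d j) α)) ∧ (∀ v, ρ.IsUnramifiedAt v → μ.IsUnramifiedAt v → (ℓ : NumberField.RingOfIntegers K) ∉ v.asIdeal → (r j).IsUnramifiedAt v) ∧ (∀ v : IsDedekindDomain.HeightOneSpectrum (NumberField.RingOfIntegers K), (ℓ : NumberField.RingOfIntegers K) ∈ v.asIdeal → ∃ (g : Matrix.GeneralLinearGroup (Fin (d j)) (PadicAlgCl ℓ)) (b : Fin (d j) → ℤ) (ψ : Fin (d j) → Literature.NumberTheory.GaloisRepresentations.FramedRep (Field.absoluteGaloisGroup (v.adicCompletion K)) (PadicAlgCl ℓ) 1), StrictAnti b ∧ (∀ i, (ψ i).IsLocallyUnramified) ∧ ∀ σ, (∀ i₁ i₂ : Fin (d j), i₂ < i₁ → (((r j).toLocal v).conj g σ).val i₁ i₂ = 0) ∧ (∀ i, (((r j).toLocal v).conj g σ).val i i = (ψ i).trace σ * (algebraMap ℚ_[ℓ] (PadicAlgCl ℓ) ((Literature.NumberTheory.GaloisRepresentations.GaloisRep.cyclotomicCharacter (v.adicCompletion K) ℓ σ : ℤ_[ℓ]ˣ) : ℤ_[ℓ])) ^ (b i))))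 ∧ (∃ χ : Literature.NumberTheory.GaloisRepresentations.FramedGaloisRep K (PadicAlgCl ℓ) 1, ∀ σ, (∑ j, (r j).trace (θ σ)) = χ.trace σ * (∑ j, (r j).trace σ⁻¹)) ∧ (∀ σ, ‖(∑ j, (r j).trace σ) - (ρ.trace σ + μ.trace σ * (Literature.NumberTheory.GaloisRepresentations.FramedRep.dual (ρ.comp θ)).trace σ)‖ ≤ ((ℓ : ℝ)⁻¹) ^ M)) → (∃ π : Literature.NumberTheory.Automorphic.CuspidalAutomorphicRepData n K hcpt, π.1.IsLAlgebraic ∧ ∀ᶠ v in Filter.cofinite, ∃ α : Multiset ℂ, π.1.HasSatakeParamAt v α ∧ ρ.IsUnramifiedAt v ∧ ρ.HasFrobCharpolyAt v (Literature.NumberTheory.Automorphic.arithFrobPolyOfSatake ι v.residueCard 1 α))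

/-- item stmt-Langlands-2692 · crux · rank 4 · open · by planner
why it might fail: A Bellaiche-Chenevier-type sign/parity constraint or an H^2 obstruction at the swapped-Siegel point could confine all polarized deformations of R0 with bounded ramification to the reducible locus; needs the polarized deformation ring of a reducible determinant to have expected dimension.
sources: arXiv:math/0602340, Chenevier2011, Thorne2014, SkinnerWiles1999
[crux] GALOIS SHADOW OF C1 (card C3): with BIND as in the target, for every a.e.-unramified μ with
μ^c = μ (tr μ(θ_c σ) = tr μ(σ)), the Siegel trace T is an ℓ-adic limit of traces of IRREDUCIBLE
2n-dimensional polarized representations r_M of Γ_K (r_M^c ≃ r_M^∨ ⊗ χ_M in trace form) unramified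
wherever ρ, μ are (v ∤ ℓ); no automorphy and no condition at ℓ is asked. Intended proof: the
polarized deformation problem of the reducible determinant R̄₀ (Chenevier determinants /
Bellaïche–Chenevier GMAs, arXiv:math/0602340 §1) has Krull dimension ≥ h¹ − h² at R₀
(obstruction-theoretic lower bound) which exceeds the dimension of the reducible (Siegel) locus ≈
dim Def_S(ρ) + 1 because K is totally imaginary (global Euler characteristic, Tate/Greenberg–Wiles);
a proper Zariski-closed subset of an irreducible rigid component has empty ℓ-adic interior, so
irreducible points approximate R₀. If this fails, C1 fails: cheapest real test of the line; largely
attackable with Galois cohomology already in the tree (GaloisCohomology, LocalGlobalCohomology). -/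
@[route_item "route-Langlands-SiegelEisensteinFern"]
def SiegelGaloisFern : Prop :=
  ∀ (K : Type) [Field K] [NumberField K] [NumberField.IsCMField K] (n : ℕ) (hcpt : Literature.NumberTheory.Automorphic.isCompact_glFiniteIntegralLevel n K), 2 ≤ n → ∀ (ℓ : ℕ) [Fact ℓ.Prime] (ι : PadicAlgCl ℓ ≃+* ℂ), (∃ F₀ : IntermediateField ℚ K, (Module.finrank ℚ F₀ = 2 ∧ NumberField.IsTotallyComplex F₀) ∧ ∃ w w' : IsDedekindDomain.HeightOneSpectrum (NumberField.RingOfIntegers F₀), w ≠ w' ∧ (ℓ : NumberField.RingOfIntegers F₀) ∈ w.asIdeal ∧ (ℓ : NumberField.RingOfIntegers F₀) ∈ w'.asIdeal) → ∀ (c : Field.absoluteGaloisGroup (NumberField.maximalRealSubfield K)) (θ : Field.absoluteGaloisGroup K →ₜ* Field.absoluteGaloisGroup K), c ∉ Set.range (Literature.NumberTheory.GaloisRepresentations.absGaloisRestrict (NumberField.maximalRealSubfield K) K) → (∀ σ, Literature.NumberTheory.GaloisRepresentations.absGaloisRestrict (NumberField.maximalRealSubfield K) K (θ σ) = c * Literature.NumberTheory.GaloisRepresentations.absGaloisRestrict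 (NumberField.maximalRealSubfield K) K σ * c⁻¹) → ∀ (ρ : Literature.NumberTheory.GaloisRepresentations.FramedGaloisRep K (PadicAlgCl ℓ) n), ρ.toGaloisRep.IsIrreducible → (¬ ∃ χ : Literature.NumberTheory.GaloisRepresentations.FramedGaloisRep K (PadicAlgCl ℓ) 1, ∀ σ, ρ.trace (θ σ) = χ.trace σ * ρ.trace σ⁻¹) → (∀ᶠ v in Filter.cofinite, ρ.IsUnramifiedAt v) → (∀ v : IsDedekindDomain.HeightOneSpectrum (NumberField.RingOfIntegers K), (ℓ : NumberField.RingOfIntegers K) ∈ v.asIdeal → ∃ (g : Matrix.GeneralLinearGroup (Fin (n)) (PadicAlgCl ℓ)) (b : Fin (n) → ℤ) (ψ : Fin (n) → Literature.NumberTheory.GaloisRepresentations.FramedRep (Field.absoluteGaloisGroup (v.adicCompletion K)) (PadicAlgCl ℓ) 1), StrictAnti b ∧ (∀ i, (ψ i).IsLocallyUnramified) ∧ ∀ σ, (∀ i₁ i₂ : Fin (n), i₂ < i₁ → (((ρ).toLocal v).conj g σ).val i₁ i₂ = 0) ∧ (∀ i, (((ρ).toLocal v).conj g σ).val i i = (ψ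 i).trace σ * (algebraMap ℚ_[ℓ] (PadicAlgCl ℓ) ((Literature.NumberTheory.GaloisRepresentations.GaloisRep.cyclotomicCharacter (v.adicCompletion K) ℓ σ : ℤ_[ℓ]ˣ) : ℤ_[ℓ])) ^ (b i))) → ∀ (μ : Literature.NumberTheory.GaloisRepresentations.FramedGaloisRep K (PadicAlgCl ℓ) 1), (∀ᶠ v in Filter.cofinite, μ.IsUnramifiedAt v) → (∀ σ, μ.trace (θ σ) = μ.trace σ) → (∀ M : ℕ, ∃ r : Literature.NumberTheory.GaloisRepresentations.FramedGaloisRep K (PadicAlgCl ℓ) (n + n), r.toGaloisRep.IsIrreducible ∧ (∀ v, ρ.IsUnramifiedAt v → μ.IsUnramifiedAt v → (ℓ : NumberField.RingOfIntegers K) ∉ v.asIdeal → (r).IsUnramifiedAt v) ∧ (∃ χ : Literature.NumberTheory.GaloisRepresentations.FramedGaloisRep K (PadicAlgCl ℓ) 1, ∀ σ, (r.trace (θ σ)) = χ.trace σ * (r.trace σ⁻¹)) ∧ (∀ σ, ‖(r.trace σ) - (ρ.trace σ + μ.trace σ * (Literature.NumberTheory.GaloisRepresentations.FramedRep.dual (ρ.comp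 θ)).trace σ)‖ ≤ ((ℓ : ℝ)⁻¹) ^ M))

/-- item stmt-Langlands-2694 · crux (kind.auto-crux: conjecture-grade) · rank 9 · open · by planner
why it might fail: auto-crux — conjecture-grade statement (docstring avows it ('conjecture')); it is open, so it may simply be false
sources: BarnetlambEtAl2014, arXiv:2603.19768, Calegari2023
[support] IRREDUCIBILITY INPUT OF C2: with BIND as in the target (ρ irreducible,
crystalline-ordinary regular, n ≥ 2) and any μ, ρ is never a proper constituent of the Galois
representation r = r_{ℓ,ι}(Q) of a cuspidal regular algebraic Q on GL_d(𝔸_K) with d > n (¬∃ ρ₂ of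
dimension d − n with tr r = tr ρ + tr ρ₂). A special case of the irreducibility conjecture for
automorphic Galois representations; known for d ≤ 6 in many regular cases and for a density-one set
of ℓ in the polarized case (Patrikis–Taylor; BarnetlambEtAl2014 §5), open for fixed ℓ in general.
Used in C2 to force the classical form with trace T to the boundary. Sources: BarnetlambEtAl2014 Thm
5.5.2-type statements; arXiv:2603.19768 (GL_4); Calegari2023 §10. -/
@[route_item "route-Langlands-SiegelEisensteinFern"]
def NoProperAutomorphicConstituent : Prop :=
  ∀ (K : Type) [Field K] [NumberField K] [NumberField.IsCMField K] (n : ℕ) (hcpt : Literature.NumberTheory.Automorphic.isCompact_glFiniteIntegralLevel n K), 2 ≤ n → ∀ (ℓ : ℕ) [Fact ℓ.Prime] (ι : PadicAlgCl ℓ ≃+* ℂ), (∃ F₀ : IntermediateField ℚ K, (Module.finrank ℚ F₀ = 2 ∧ NumberField.IsTotallyComplex F₀) ∧ ∃ w w' : IsDedekindDomain.HeightOneSpectrum (NumberField.RingOfIntegers F₀), w ≠ w' ∧ (ℓ : NumberField.RingOfIntegers F₀) ∈ w.asIdeal ∧ (ℓ : NumberField.RingOfIntegers F₀) ∈ w'.asIdeal)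 → ∀ (c : Field.absoluteGaloisGroup (NumberField.maximalRealSubfield K)) (θ : Field.absoluteGaloisGroup K →ₜ* Field.absoluteGaloisGroup K), c ∉ Set.range (Literature.NumberTheory.GaloisRepresentations.absGaloisRestrict (NumberField.maximalRealSubfield K) K) → (∀ σ, Literature.NumberTheory.GaloisRepresentations.absGaloisRestrict (NumberField.maximalRealSubfield K) K (θ σ) = c * Literature.NumberTheory.GaloisRepresentations.absGaloisRestrict (NumberField.maximalRealSubfield K) K σ * c⁻¹) → ∀ (ρ : Literature.NumberTheory.GaloisRepresentations.FramedGaloisRep K (PadicAlgCl ℓ) n), ρ.toGaloisRep.IsIrreducible → (¬ ∃ χ : Literature.NumberTheory.GaloisRepresentations.FramedGaloisRep K (PadicAlgCl ℓ) 1, ∀ σ, ρ.trace (θ σ) = χ.trace σ * ρ.trace σ⁻¹) → (∀ᶠ v in Filter.cofinite, ρ.IsUnramifiedAt v) → (∀ v : IsDedekindDomain.HeightOneSpectrum (NumberField.RingOfIntegers K), (ℓ : NumberField.RingOfIntegers K) ∈ v.asIdeal → ∃ (g : Matrix.GeneralLinearGroup (Fin (n)) (PadicAlgCl ℓ)) (b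 : Fin (n) → ℤ) (ψ : Fin (n) → Literature.NumberTheory.GaloisRepresentations.FramedRep (Field.absoluteGaloisGroup (v.adicCompletion K)) (PadicAlgCl ℓ) 1), StrictAnti b ∧ (∀ i, (ψ i).IsLocallyUnramified) ∧ ∀ σ, (∀ i₁ i₂ : Fin (n), i₂ < i₁ → (((ρ).toLocal v).conj g σ).val i₁ i₂ = 0) ∧ (∀ i, (((ρ).toLocal v).conj g σ).val i i = (ψ i).trace σ * (algebraMap ℚ_[ℓ] (PadicAlgCl ℓ) ((Literature.NumberTheory.GaloisRepresentations.GaloisRep.cyclotomicCharacter (v.adicCompletion K) ℓ σ : ℤ_[ℓ]ˣ) : ℤ_[ℓ])) ^ (b i))) → ∀ (μ : Literature.NumberTheory.GaloisRepresentations.FramedGaloisRep K (PadicAlgCl ℓ) 1) (d : ℕ) (hd : Literature.NumberTheory.Automorphic.isCompact_glFiniteIntegralLevel d K) (Q : Literature.NumberTheory.Automorphic.CuspidalAutomorphicRepData d K hd) (r : Literature.NumberTheory.GaloisRepresentations.FramedGaloisRep K (PadicAlgCl ℓ) d), n < d → Q.1.IsRegularAlgebraic → (∀ v (α : Multiset ℂ),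 (Q).1.HasSatakeParamAt v α → (ℓ : NumberField.RingOfIntegers K) ∉ v.asIdeal → (r).IsUnramifiedAt v ∧ (r).HasFrobCharpolyAt v (Literature.NumberTheory.Automorphic.arithFrobPolyOfSatake ι v.residueCard (d) α)) → ¬ ∃ ρ₂ : Literature.NumberTheory.GaloisRepresentations.FramedGaloisRep K (PadicAlgCl ℓ) (d - n), ∀ σ, r.trace σ = ρ.trace σ + ρ₂.trace σ

/-- item stmt-Langlands-2693 · support · rank 9 · open · by planner
sources: HarrisLanTaylorThorneRMS2016 §6, SkinnerUrban2014, Hida2002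
[support] FORWARD DIRECTION = HLTT §6 in ordinary form (interface check): with BIND as in the
target, if ρ = r_{ℓ,ι}(π) for a cuspidal regular algebraic π on GL_n(𝔸_K) (lang.S27 matching), then
for some a.e.-unramified μ the Siegel trace T is an ℓ-adic limit of ordinary polarized
cuspidal-automorphic traces exactly as in SiegelLimitExistence. In print modulo packaging:
HarrisLanTaylorThorneRMS2016 p.90 Lemma 6.2 & Cor 6.3–6.4 (ordinary Hecke algebras on U(n,n) are 'of
Galois type' via Katz density + Galois reps of cuspidal Π on the unitary similitude group) and p.101
Cor 6.25–6.27 (π ⊠ twist occurs in the boundary and its eigensystem is interpolated); the ordinary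
refinement (slope 0 approximants of trivial nebentypus, i.e. Hida family members through the
ordinary Eisenstein point) as in SkinnerUrban2014 for U(2,2). A grounder may vendor it as a
Literature named fact; if it is FALSE as typed, the interface (cuspidal families / ordinarity clause
/ level clause) is mis-specified and C1, C2 must be restated, not closed. -/
@[route_item "route-Langlands-SiegelEisensteinFern"]
def SiegelLimitOfAutomorphic : Prop :=
  ∀ (K : Type) [Field K] [NumberField K] [NumberField.IsCMField K] (n : ℕ) (hcpt : Literature.NumberTheory.Automorphic.isCompact_glFiniteIntegralLevel n K), 2 ≤ n → ∀ (ℓ : ℕ) [Fact ℓ.Prime] (ι : PadicAlgCl ℓ ≃+* ℂ), (∃ F₀ : IntermediateField ℚ K, (Module.finrank ℚ F₀ = 2 ∧ NumberField.IsTotallyComplex F₀) ∧ ∃ w w' : IsDedekindDomain.HeightOneSpectrum (NumberField.RingOfIntegers F₀), w ≠ w' ∧ (ℓ : NumberField.RingOfIntegers F₀) ∈ w.asIdeal ∧ (ℓ : NumberField.RingOfIntegers F₀) ∈ w'.asIdeal) → ∀ (c : Field.absoluteGaloisGroup (NumberField.maximalRealSubfield K)) (θ : Field.absoluteGaloisGroup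 K →ₜ* Field.absoluteGaloisGroup K), c ∉ Set.range (Literature.NumberTheory.GaloisRepresentations.absGaloisRestrict (NumberField.maximalRealSubfield K) K) → (∀ σ, Literature.NumberTheory.GaloisRepresentations.absGaloisRestrict (NumberField.maximalRealSubfield K) K (θ σ) = c * Literature.NumberTheory.GaloisRepresentations.absGaloisRestrict (NumberField.maximalRealSubfield K) K σ * c⁻¹) → ∀ (ρ : Literature.NumberTheory.GaloisRepresentations.FramedGaloisRep K (PadicAlgCl ℓ) n), ρ.toGaloisRep.IsIrreducible → (¬ ∃ χ : Literature.NumberTheory.GaloisRepresentations.FramedGaloisRep K (PadicAlgCl ℓ) 1, ∀ σ, ρ.trace (θ σ) = χ.trace σ * ρ.trace σ⁻¹) → (∀ᶠ v in Filter.cofinite, ρ.IsUnramifiedAt v) → (∀ v : IsDedekindDomain.HeightOneSpectrum (NumberField.RingOfIntegers K), (ℓ : NumberField.RingOfIntegers K) ∈ v.asIdeal → ∃ (g : Matrix.GeneralLinearGroup (Fin (n)) (PadicAlgCl ℓ)) (b : Fin (n) → ℤ) (ψ : Fin (n) → Literature.NumberTheory.GaloisRepresentations.FramedRep (Field.absoluteGaloisGroup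 (v.adicCompletion K)) (PadicAlgCl ℓ) 1), StrictAnti b ∧ (∀ i, (ψ i).IsLocallyUnramified) ∧ ∀ σ, (∀ i₁ i₂ : Fin (n), i₂ < i₁ → (((ρ).toLocal v).conj g σ).val i₁ i₂ = 0) ∧ (∀ i, (((ρ).toLocal v).conj g σ).val i i = (ψ i).trace σ * (algebraMap ℚ_[ℓ] (PadicAlgCl ℓ) ((Literature.NumberTheory.GaloisRepresentations.GaloisRep.cyclotomicCharacter (v.adicCompletion K) ℓ σ : ℤ_[ℓ]ˣ) : ℤ_[ℓ])) ^ (b i))) → (∃ π : Literature.NumberTheory.Automorphic.CuspidalAutomorphicRepData n K hcpt, π.1.IsRegularAlgebraic ∧ (∀ v (α : Multiset ℂ), (π).1.HasSatakeParamAt v α → (ℓ : NumberField.RingOfIntegers K) ∉ v.asIdeal → (ρ).IsUnramifiedAt v ∧ (ρ).HasFrobCharpolyAt v (Literature.NumberTheory.Automorphic.arithFrobPolyOfSatake ι v.residueCard (n) α))) → ∃ μ : Literature.NumberTheory.GaloisRepresentations.FramedGaloisRep K (PadicAlgCl ℓ) 1, (∀ᶠ v in Filter.cofinite, μ.IsUnramifiedAt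 v) ∧ (∀ M : ℕ, ∃ (k : ℕ) (d : Fin k → ℕ) (hd : ∀ j, Literature.NumberTheory.Automorphic.isCompact_glFiniteIntegralLevel (d j) K) (P : ∀ j, Literature.NumberTheory.Automorphic.CuspidalAutomorphicRepData (d j) K (hd j)) (r : ∀ j, Literature.NumberTheory.GaloisRepresentations.FramedGaloisRep K (PadicAlgCl ℓ) (d j)), (∑ j, d j = n + n) ∧ (∀ j, (P j).1.IsRegularAlgebraic ∧ (∀ v (α : Multiset ℂ), (P j).1.HasSatakeParamAt v α → (ℓ : NumberField.RingOfIntegers K) ∉ v.asIdeal → (r j).IsUnramifiedAt v ∧ (r j).HasFrobCharpolyAt v (Literature.NumberTheory.Automorphic.arithFrobPolyOfSatake ι v.residueCard (d j) α)) ∧ (∀ v, ρ.IsUnramifiedAt v → μ.IsUnramifiedAt v → (ℓ : NumberField.RingOfIntegers K) ∉ v.asIdeal → (r j).IsUnramifiedAt v) ∧ (∀ v : IsDedekindDomain.HeightOneSpectrum (NumberField.RingOfIntegers K), (ℓ : NumberField.RingOfIntegers K) ∈ v.asIdeal → ∃ (g : Matrix.GeneralLinearGroup (Fin (d j)) (PadicAlgCl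 ℓ)) (b : Fin (d j) → ℤ) (ψ : Fin (d j) → Literature.NumberTheory.GaloisRepresentations.FramedRep (Field.absoluteGaloisGroup (v.adicCompletion K)) (PadicAlgCl ℓ) 1), StrictAnti b ∧ (∀ i, (ψ i).IsLocallyUnramified) ∧ ∀ σ, (∀ i₁ i₂ : Fin (d j), i₂ < i₁ → (((r j).toLocal v).conj g σ).val i₁ i₂ = 0) ∧ (∀ i, (((r j).toLocal v).conj g σ).val i i = (ψ i).trace σ * (algebraMap ℚ_[ℓ] (PadicAlgCl ℓ) ((Literature.NumberTheory.GaloisRepresentations.GaloisRep.cyclotomicCharacter (v.adicCompletion K) ℓ σ : ℤ_[ℓ]ˣ) : ℤ_[ℓ])) ^ (b i)))) ∧ (∃ χ : Literature.NumberTheory.GaloisRepresentations.FramedGaloisRep K (PadicAlgCl ℓ) 1, ∀ σ, (∑ j, (r j).trace (θ σ)) = χ.trace σ * (∑ j, (r j).trace σ⁻¹)) ∧ (∀ σ, ‖(∑ j, (r j).trace σ) - (ρ.trace σ + μ.trace σ * (Literature.NumberTheory.GaloisRepresentations.FramedRep.dual (ρ.comp θ)).trace σ)‖ ≤ ((ℓ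 : ℝ)⁻¹) ^ M))

/-- item stmt-Langlands-2695 · support · rank 9 · open · by planner
sources: BuzzardGeeLMS2014, ACCGHLNSTT2023
[support] COMPLEMENT, NOT THIS ROUTE'S BUSINESS: SiegelFernTarget → Langlands. Everything in the
summit beyond the ordinary/regular/CM/non-polarizable (B)-slice: direction (A) with local–global
compatibility at every place, (B) for polarizable ρ (CHT/BLGGT territory), non-ordinary or irregular
ρ, n = 1 (CFT), CM fields without a split imaginary quadratic subfield (base change + Sorensen
patching as in HLTT Cor 7.14) and non-CM fields, and the upgrade from a.e. matching to
`Corresponds`. Shared glue for the Langlands summit; expected to be discharged only by the union of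
other routes. Filed so the assembly chain is formally closed (pattern of NavierStokes
GaldiLiouvilleGate.NoBlowupToClay). -/
@[route_item "route-Langlands-SiegelEisensteinFern", crux]
def BeyondSiegelFern : Prop :=
  SiegelFernTarget → _root_.Langlands

/-- item stmt-Langlands-2696 · assembly · rank 1 · open · by planner
[assembly] SiegelLimitExistence → SiegelLimitReciprocity → BeyondSiegelFern → Langlands. A
tautology: C1 gives μ and the limit, C2 turns the limit into automorphy of ρ, i.e. SiegelFernTarget,
and the complement does the rest (proof term checked on the farm: AssemblyTest.lean, axioms
propext/Classical.choice/Quot.sound; attached as evidence). -/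
@[route_item "route-Langlands-SiegelEisensteinFern"]
def Assembly : Prop :=
  SiegelLimitExistence → SiegelLimitReciprocity → BeyondSiegelFern → _root_.Langlands

/-! D-0027 §2.1 — DECIDING THEOREM (planner-authored via `route open/edit --closes-file`; by planner-rbadge-Langlands-SiegelEisensteinFern-9bbb4f14-g4-0 2026-08-15T16:09:13Z):
its hypotheses are this route's items and its conclusion the sub-problem Statement (glue_lint), and it elaborates with this file. -/

/-- Route glue (D-0027 §2.1). Fix the binding data of `SiegelFernTarget` (K CM with a split
imaginary quadratic subfield at ℓ, n ≥ 2, ι, c, θ, ρ irreducible, non-polarizable, a.e. unramified,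
crystalline-ordinary regular above ℓ). Crux C1 `SiegelLimitExistence` supplies the character μ and
the ℓ-adic limit presentation of the Siegel–Eisenstein trace `tr ρ + μ·tr (ρ∘θ)^∨` by ordinary
polarized cuspidal-automorphic traces; crux C2 `SiegelLimitReciprocity` turns exactly that limit into
a cuspidal L-algebraic π on GL_n(𝔸_K) with a.e. Satake–Frobenius matching, i.e. `SiegelFernTarget`;
the complement `BeyondSiegelFern : SiegelFernTarget → Langlands` does the rest of the summit. -/
@[closes "route-Langlands-SiegelEisensteinFern"] theorem closes (hC1 : SiegelLimitExistence) (hC2 : SiegelLimitReciprocity)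
    (hB : BeyondSiegelFern) : _root_.Langlands := by
  refine hB ?_
  intro K _ _ _ n hcpt hn ℓ _ ι hF c θ hc hθ ρ hirr hnp hunr hord
  obtain ⟨μ, -, hlim⟩ := hC1 K n hcpt hn ℓ ι hF c θ hc hθ ρ hirr hnp hunr hord
  exact hC2 K n hcpt hn ℓ ι hF c θ hc hθ ρ hirr hnp hunr hord μ hlim

end Summit.Langlands.Langlands.Theses.SiegelEisensteinFern
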